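import Summits.QuantumFields.YangMills.Theorems.FluctuationComparisonRegPrIntLHeightwiseQuotientAnchoring
import Summits.QuantumFields.YangMills.Theorems.AlphaInputsT3ACv4ChiInt
import Literature.MathematicalPhysics.QuantumFieldTheory.Balaban1983to89.T3InteriorExcision
import HarnessLib

/-!
# UP∘-QUOT (A′-χ) — SAME-LEVEL ANCHORING ON THE χ∕ROWS ROAD: the two halves of [Balaban1985UV3] Thm 2 at ONE level of the pinned `ℰp` tower over the
# VERSION-AGNOSTIC rows record `AlphaInputsT3AC.PkgCoreRows` (upper half, (41)) and the v4 χ-package `AlphaInputsT3AC.PkgAtV4Chi` (lower half, (47) on the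
# INTERIOR window), anchor `exp(−(E_{K−n} − E))` CANCELLED — rows as explicit hypotheses

Cell `ym3-torus` (YM ladder rung R3 = continuum `SU(2)` Yang–Mills on the three-torus — a RUNG, NOT d = 4, NOT infinite volume, NOT a mass gap, NOT Clay).  Width seat
`ym-ust-20520-w5` (gen 18); `--supports stmt-QuantumFields-20520 --as helper`, count-neutral, definition-free, default heartbeats.  The χ∕rows EDITION of seat
`ym-ust-20520-w3` (gen 19)'s ✓ `…HeightwiseQuotientAnchoring` (A) (★★OWNER RULING №44 «socket of record := `PkgCoreRows` ∕ `OfV4ChiAt` ∕ `AlphaInputsT3ACv4RecChi`»,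
after ym3-torus-px8 g15's census: the v3 socket's rows L-67 `hLF67` and A-2 `fibre57Low` have no supplier of record).  §1 (generic anchoring) and §3's window-volume
identity of (A) are IMPORTED, not restated.

WHAT CHANGES AGAINST (A).  The UPPER half is a letter-for-letter port (`PkgAtV3.resDensity_le_sum_ae ↦ PkgCoreRows.resDensity_le_sum_ae`).  The LOWER half is NOT:
(A) read ✓`PkgAtV3.le_resDensity_ae` — (47)′ with print's `χ_j`, equal to `1` on the FULL window `{PlaqSmall θBal(K − j)}`, a row descending from the v3-only step row A-2
(`fibre57Low`, FIELD window).  On the χ road (47) is the χ step packages' `fibre57LowOn` (print's χ ON THE MINIMISER) and the tree's reading for the route's density is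
✓`AlphaInputsT3ACv4ChiInt.PkgAtV4Chi.le_resDensity_int_ae (ha₁ : ∀ i, θBal … i ≤ p.a₁)`: the INDICATOR of the INTERIOR window `intWindowT3 j = {PlaqSmall (θBal(K−j) ∕ max B₃ 1)}`
([Balaban1985Variational] Thm 1 (8): data in the window shrunk by the regularity constant `B₃` have `θBal`-regular minimisers — row r1 at the free radius).  Hence every
lower-side statement below lives on the window `PlaqSmall (θBal F.L γ 𝔠.b₀ 𝔠.p₀ n ∕ max 𝔠.B₃ 1)`; §4 records the profile-shift identity `θBal(B·b₀)∕B = θBal(b₀)` by which a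
capstone that knows `𝔠.B₃` UNIFORMLY in the profile (the supplier ✓`pinnedPartsT3ACRecSelXsV4Chi_of_thm1_rows` pins `𝔠.B₃ = B` per block size) recovers print's full window
at the caller's profile.
* §2 (`q : PkgCoreRows`, `p : PkgAtV4Chi`, level `j ≤ K`) `wtP_nonneg_rows`; ★★ `ae_resDensity_le_anchor_rows` (upper half, anchor kept); `mem_intWindowT3_iff`;
  ★★ `ae_anchor_le_resDensity_int` (lower half on the INTERIOR window, anchor kept; main-term letter asked on the interior window only).
* §3 `mem_intWindowT3_level_iff` (`K − (K − n) = n`), `intWindow_radius_pos`, ★★★ `ae_quotient_bounds_level_chi` — a.e. `Z_K⁻¹ρ^{univ}_{K−n} ≤ (CRu·e^{CP}·B)∕(CRu⁻¹·e^{−M−CP}·vol′_n)`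
  and, a.e. on the interior window, `(CRu⁻¹e^{−M−CP})∕(CRu·e^{CP}·B) ≤ Z_K⁻¹ρ^{univ}_{K−n}`, `vol′_n` = the height-`n` Haar volume of the interior window (K-free by (A)
  `measureReal_window_level_eq`, positive by ✓`fieldMeasure_plaqSmall_pos`).
* §4 `θBal_profile_mul_div`, `plaqSmall_interior_of_profile_mul_iff` — the profile-shift letters (lit ✓`θBal_mul`).
Every analytic row is a displayed hypothesis with a named supplier on the rows road: B25 at the level (`hBae`, ym3-torus-px8's `…LargeFieldEnvelope…` rows edition), (46)
(`hP`, ✓`UnitScaleTiltHistoryTailIntPintRows` `PkgCoreRows.abs_Pint_succ_le`), the remainder (`hRm`, ✓`PkgCoreRows.Rm_eq`), the trivial-history main term on the window (`hM`,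
seat w4-20520's `…HeightwiseMainTermRows`); the package knit (B′) plugs them by name.

HONEST SCOPE.  Bookkeeping; nothing of Theorem 1∕2, UP∘, LOWB∘, PERS₁∘, 20520 or the rung is proved here; the (α) rows of every socket version are OPEN hypothesis schemas
(0∕23 data rows landed); rung R3 = SU(2) YM₃ on T³ — NOT d = 4, NOT infinite volume, NOT a mass gap, NOT Clay.  Sorry-free, axioms standard.

References: T. Bałaban, CMP **102** (1985) 255–275 [Balaban1985UV3] ((1)–(7) pp.256–257, (41)+(43) p.266, (46)–(47) p.267, (62) p.271, (64) p.273, Thm 2 p.272,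
pp.273–274); T. Bałaban, CMP **102** (1985) 277–309 [Balaban1985Variational] (Thm 1 (8) p.279); T. Bałaban, CMP **109** (1987) 249–301 [Balaban1987RG1] ((0.1)–(0.4) pp.251–253).
-/

set_option autoImplicit false

noncomputable section

namespace Summit.QuantumFields.YangMills.Theorems.FluctuationComparisonRegPrIntLHeightwiseQuotientAnchoringChi

open MeasureTheory
open scoped BigOperators
open Literature.MathematicalPhysics.QuantumFieldTheory.Balaban1983to89
open Literature.MathematicalPhysics.QuantumFieldTheory.Balaban1983to89.T3ContinuumYM3Torus
open Literature.MathematicalPhysics.QuantumFieldTheory.Balaban1983to89.T3UnitLawDensityEML (ℰp emlDensity)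
open Literature.MathematicalPhysics.QuantumFieldTheory.Balaban1983to89.T3UnitScaleTilt (θBal measurableSet_plaqSmall)
open Literature.MathematicalPhysics.QuantumFieldTheory.Balaban1983to89.T3RestrictedUnitDensity (resDensity resDensity_nonneg integrable_resDensity)
open Literature.MathematicalPhysics.QuantumFieldTheory.Balaban1983to89.T3TiltDescent (heightDensity)
open Literature.MathematicalPhysics.QuantumFieldTheory.Balaban1983to89.T3HeightwiseDensityBounds
open Literature.MathematicalPhysics.QuantumFieldTheory.Balaban1983to89.T3LevelShift (fieldShift measurePreserving_fieldShift)
open Literature.MathematicalPhysics.QuantumFieldTheory.Balaban1983to89.T3InteriorExcision (θBal_mul)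
open Literature.MathematicalPhysics.QuantumFieldTheory.Balaban1983to89.Missing (partitionFn partitionFn_pos' isProbabilityMeasure_fieldMeasure)
open Literature.MathematicalPhysics.QuantumFieldTheory.Balaban1985CMP102
open Literature.MathematicalPhysics.QuantumFieldTheory.Balaban1985CMP102.Setting
open Summit.QuantumFields.Balaban3D.Carriers
open Summit.QuantumFields.Balaban3D.Proofs.Primitives
open Summit.QuantumFields.Balaban3D.Proofs.InputsAC
open Summit.QuantumFields.YangMills.Theorems.FluctuationComparisonRegPrIntLHeightwiseQuotientAnchoring

/-! ## §2 The two halves at level `j` of run `K` on the rows road, `dV_j`-a.e., with the level anchor `exp(−(E_j − E))` KEPT -/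

section Halves

variable {F : T3Family} {𝔠 : AlphaConsts F.L (suGroupModel 2).N} {γ : ℝ} {hγ : 0 < γ} {hγ1 : γ ≤ (min 𝔠.gamma0 1) ^ 2} {K : ℕ}

/-- `0 ≤ wtP` for the rows record's windowed pinned weights (`PinnedStep.wtP_nonneg_le`). [cite: Balaban1985UV3, (40)–(41) p.266] -/
theorem wtP_nonneg_rows (q : AlphaInputsT3AC.PkgCoreRows F 𝔠 γ hγ hγ1 K) (j : ℕ) (r : Hist (F.P K) j)
    (W : GaugeField (F.P K) j (Matrix.specialUnitaryGroup (Fin 2) ℂ)) : 0 ≤ q.wtP j r W :=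
  (PinnedStep.wtP_nonneg_le 𝔠.lane q.X (AlphaInputsT3AC.admWindowT3 F 𝔠 γ hγ hγ1 K) j r W).1

/-- ★★ **UPPER HALF AT LEVEL `j` OVER THE ROWS RECORD, ANCHOR KEPT**: IF at level `j ≤ K` the interaction sums are bounded above (`Pint_j(r, W) ≤ CP`, every history — (46)),
the remainder is bounded (`exp(Rm_j) ≤ CRu`) and the (41) LARGE-FIELD HISTORY SUM WITH THE PINNED WEIGHTS is essentially bounded (`Σ_r wtP_j(r,W)·e^{−mainT_j(r,W) + Zterm_j(r)} ≤ B`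
a.e.), THEN a.e. `resDensity F γ K univ j W ≤ exp(−(E_j − E))·(CRu·exp(CP)·B)` — (41)′ with the windowed pinned weights over the version-agnostic rows record
(✓`PkgCoreRows.resDensity_le_sum_ae`), `Pint` pulled out of the sum by `wtP ≥ 0`.  (A)'s `ae_resDensity_le_anchor` with `PkgAtV3 ↦ PkgCoreRows`.
[cite: Balaban1985UV3, (41) p.266 + (46) p.267 + pp.273–274] -/
theorem ae_resDensity_le_anchor_rows (q : AlphaInputsT3AC.PkgCoreRows F 𝔠 γ hγ hγ1 K) (j : ℕ) (hj : j ≤ K) {CP CRu B : ℝ}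
    (hP : ∀ (r : Hist (F.P K) j) (W : GaugeField (F.P K) j (Matrix.specialUnitaryGroup (Fin 2) ℂ)), q.T.Pint j r W ≤ CP)
    (hRm : Real.exp (q.T.Rm j) ≤ CRu)
    (hB : ∀ᵐ W ∂fieldMeasure (F.P K) j (Matrix.specialUnitaryGroup (Fin 2) ℂ),
      ∑ r : Hist (F.P K) j, q.wtP j r W * Real.exp (-(q.T.mainT j r W) + q.T.Zterm j r) ≤ B) :
    ∀ᵐ W ∂fieldMeasure (F.P K) j (Matrix.specialUnitaryGroup (Fin 2) ℂ),
      resDensity F γ K Set.univ j W ≤ Real.exp (-(q.T.Ecst j - q.E)) * (CRu * Real.exp CP * B) := by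
  filter_upwards [q.resDensity_le_sum_ae j hj, hB] with W h41 hBW
  -- the sum with `Pint` is at most `e^{CP}` times the sum without
  have hsum : ∑ r : Hist (F.P K) j, q.wtP j r W * Real.exp (-(q.T.mainT j r W) + q.T.Pint j r W + q.T.Zterm j r) ≤
      Real.exp CP * ∑ r : Hist (F.P K) j, q.wtP j r W * Real.exp (-(q.T.mainT j r W) + q.T.Zterm j r) := by
    rw [Finset.mul_sum]
    refine Finset.sum_le_sum fun r _ => ?_
    have hw := wtP_nonneg_rows q j r W
    have hexp : Real.exp (-(q.T.mainT j r W) + q.T.Pint j r W + q.T.Zterm j r) ≤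
        Real.exp CP * Real.exp (-(q.T.mainT j r W) + q.T.Zterm j r) := by
      rw [← Real.exp_add]
      exact Real.exp_le_exp.mpr (by linarith [hP r W])
    calc q.wtP j r W * Real.exp (-(q.T.mainT j r W) + q.T.Pint j r W + q.T.Zterm j r)
        ≤ q.wtP j r W * (Real.exp CP * Real.exp (-(q.T.mainT j r W) + q.T.Zterm j r)) := mul_le_mul_of_nonneg_left hexp hw
      _ = Real.exp CP * (q.wtP j r W * Real.exp (-(q.T.mainT j r W) + q.T.Zterm j r)) := by ring
  have hB0 : 0 ≤ B := le_trans (Finset.sum_nonneg fun r _ => mul_nonneg (wtP_nonneg_rows q j r W) (Real.exp_nonneg _)) hBW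
  have hsplit : Real.exp (-(q.T.Ecst j - q.E) + q.T.Rm j) = Real.exp (-(q.T.Ecst j - q.E)) * Real.exp (q.T.Rm j) := Real.exp_add _ _
  calc resDensity F γ K Set.univ j W
      ≤ Real.exp (-(q.T.Ecst j - q.E) + q.T.Rm j) *
          ∑ r : Hist (F.P K) j, q.wtP j r W * Real.exp (-(q.T.mainT j r W) + q.T.Pint j r W + q.T.Zterm j r) := h41
    _ ≤ Real.exp (-(q.T.Ecst j - q.E) + q.T.Rm j) * (Real.exp CP * B) :=
        mul_le_mul_of_nonneg_left (hsum.trans (mul_le_mul_of_nonneg_left hBW (Real.exp_nonneg _))) (Real.exp_nonneg _)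
    _ = Real.exp (-(q.T.Ecst j - q.E)) * (Real.exp (q.T.Rm j) * Real.exp CP * B) := by rw [hsplit]; ring
    _ ≤ Real.exp (-(q.T.Ecst j - q.E)) * (CRu * Real.exp CP * B) :=
        mul_le_mul_of_nonneg_left (mul_le_mul_of_nonneg_right (mul_le_mul_of_nonneg_right hRm (Real.exp_nonneg _)) hB0)
          (Real.exp_nonneg _)

/-- Membership in the interior field window of level `j`, unfolded: `W ∈ intWindowT3 F 𝔠 γ K j ↔ PlaqSmall (θBal(K − j) ∕ max B₃ 1) W`. [cite: Balaban1985Variational, Thm 1 (8) p.279] -/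
theorem mem_intWindowT3_iff (j : ℕ) (W : GaugeField (F.P K) j (Matrix.specialUnitaryGroup (Fin 2) ℂ)) :
    W ∈ AlphaInputsT3AC.intWindowT3 F 𝔠 γ K j ↔ PlaqSmall (θBal F.L γ 𝔠.b₀ 𝔠.p₀ (K - j) / max 𝔠.B₃ 1) W :=
  Iff.rfl

/-- ★★ **LOWER HALF AT LEVEL `j` ON THE INTERIOR WINDOW, ANCHOR KEPT (χ road)**: IF at level `j ≤ K` the trivial-history main term is bounded on the INTERIOR window
(`mainT_j(triv, W) ≤ M` for `W ∈ intWindowT3 j` — [Balaban1985Variational] Thm 1 regularity, seat w4-20520's main-term row; asked on the interior window only), the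
trivial-history interaction sum is bounded below (`−CP ≤ Pint_j(triv, W)` — (46)), `exp(Rm_j) ≤ CRu`, and the data-smallness letter `θBal(i) ≤ a₁` holds at every height,
THEN a.e. on the interior window `exp(−(E_j − E))·(CRu⁻¹·exp(−M − CP)) ≤ resDensity F γ K univ j W` — (47)′ in the v4 χ-package's reading
✓`PkgAtV4Chi.le_resDensity_int_ae` (indicator `= 1` on the set).  (A)'s `ae_anchor_le_resDensity` with print's `χ_j` on the full window REPLACED by the interior indicator.
[cite: Balaban1985UV3, (47) p.267 + Thm 2 p.272; Balaban1985Variational, Thm 1 (8) p.279] -/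
theorem ae_anchor_le_resDensity_int (p : AlphaInputsT3AC.PkgAtV4Chi F 𝔠 γ hγ hγ1 K)
    (ha₁ : ∀ i : ℕ, θBal F.L γ 𝔠.b₀ 𝔠.p₀ i ≤ p.a₁) (j : ℕ) (hj : j ≤ K) {CP CRu M : ℝ}
    (hPl : ∀ (W : GaugeField (F.P K) j (Matrix.specialUnitaryGroup (Fin 2) ℂ)), -CP ≤ p.toRows.T.Pint j (p.toRows.T.triv j) W)
    (hRm : Real.exp (p.toRows.T.Rm j) ≤ CRu)
    (hM : ∀ (W : GaugeField (F.P K) j (Matrix.specialUnitaryGroup (Fin 2) ℂ)), W ∈ AlphaInputsT3AC.intWindowT3 F 𝔠 γ K j →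
      p.toRows.T.mainT j (p.toRows.T.triv j) W ≤ M) :
    ∀ᵐ W ∂fieldMeasure (F.P K) j (Matrix.specialUnitaryGroup (Fin 2) ℂ),
      W ∈ AlphaInputsT3AC.intWindowT3 F 𝔠 γ K j →
        Real.exp (-(p.toRows.T.Ecst j - p.toRows.E)) * (CRu⁻¹ * Real.exp (-M - CP)) ≤ resDensity F γ K Set.univ j W := by
  filter_upwards [p.le_resDensity_int_ae ha₁ j hj] with W h47 hWS
  have hind : (AlphaInputsT3AC.intWindowT3 F 𝔠 γ K j).indicator (fun _ => (1 : ℝ)) W = 1 := Set.indicator_of_mem hWS _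
  rw [hind, one_mul] at h47
  refine le_trans ?_ h47
  have hsplit : Real.exp (-(p.toRows.T.Ecst j - p.toRows.E) - p.toRows.T.Rm j) =
      Real.exp (-(p.toRows.T.Ecst j - p.toRows.E)) * Real.exp (-(p.toRows.T.Rm j)) := by
    rw [← Real.exp_add]; ring_nf
  rw [hsplit, mul_assoc]
  refine mul_le_mul_of_nonneg_left ?_ (Real.exp_nonneg _)
  have h1 : CRu⁻¹ ≤ Real.exp (-(p.toRows.T.Rm j)) := by
    rw [Real.exp_neg]
    exact inv_anti₀ (Real.exp_pos _) hRm
  have h2 : Real.exp (-M - CP) ≤ Real.exp (-(p.toRows.T.mainT j (p.toRows.T.triv j) W) + p.toRows.T.Pint j (p.toRows.T.triv j) W) :=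
    Real.exp_le_exp.mpr (by linarith [hM W hWS, hPl W])
  exact mul_le_mul h1 h2 (Real.exp_nonneg _) (Real.exp_nonneg _)

end Halves


/-! ## §3 At height `n`: the interior window at level `K − n`, its `K`-free volume, and the two-sided quotient bounds -/

section Height

variable {F : T3Family} {n K : ℕ} {𝔠 : AlphaConsts F.L (suGroupModel 2).N} {γ : ℝ} {hγ : 0 < γ} {hγ1 : γ ≤ (min 𝔠.gamma0 1) ^ 2}

/-- **THE INTERIOR WINDOW AT LEVEL `K − n` IS THE HEIGHT-`n` INTERIOR WINDOW**: `W ∈ intWindowT3 F 𝔠 γ K (K − n) ↔ PlaqSmall (θBal(n) ∕ max B₃ 1) W` (`K − (K − n) = n`).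
[cite: Balaban1985Variational, Thm 1 (8) p.279] -/
theorem mem_intWindowT3_level_iff (hK : n ≤ K) (W : GaugeField (F.P K) (K - n) (Matrix.specialUnitaryGroup (Fin 2) ℂ)) :
    W ∈ AlphaInputsT3AC.intWindowT3 F 𝔠 γ K (K - n) ↔ PlaqSmall (θBal F.L γ 𝔠.b₀ 𝔠.p₀ n / max 𝔠.B₃ 1) W := by
  rw [mem_intWindowT3_iff, Nat.sub_sub_self hK]

/-- The interior radius `θBal(n) ∕ max B₃ 1` is positive on the coupling window. [cite: Balaban1985UV3, (7) p.257] -/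
theorem intWindow_radius_pos (𝔠 : AlphaConsts F.L (suGroupModel 2).N) {γ : ℝ} (hγ : 0 < γ) (hγ1 : γ ≤ (min 𝔠.gamma0 1) ^ 2) (n : ℕ) :
    0 < θBal F.L γ 𝔠.b₀ 𝔠.p₀ n / max 𝔠.B₃ 1 :=
  div_pos (θBal_pos_of_window 𝔠 hγ hγ1 n) (lt_of_lt_of_le one_pos (le_max_right _ _))

/-- ★★★ **THE TWO-SIDED QUOTIENT BOUNDS AT LEVEL `K − n` ON THE χ∕ROWS ROAD — THE ANCHOR `exp(−(E_{K−n} − E))` CANCELS.**  For the v4 χ-package `p` at `(γ, K)` with the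
data-smallness letter `θBal(i) ≤ a₁` (every `i`), given at level `j = K − n`: the (46) bound `|Pint_j| ≤ CP` (every history), `exp(Rm_j) ≤ CRu`, the (41) large-field
history-sum bound `B` a.e. for the rows record `p.toRows`, and the main-term row `mainT_j(triv, W) ≤ M` on the INTERIOR window `{PlaqSmall (θBal(n) ∕ max B₃ 1)}`: a.e.
`Z_K⁻¹·ρ^{univ}_j ≤ (CRu·e^{CP}·B) ∕ (CRu⁻¹·e^{−M−CP}·vol′_n)` and, a.e. on the interior window, `(CRu⁻¹·e^{−M−CP}) ∕ (CRu·e^{CP}·B) ≤ Z_K⁻¹·ρ^{univ}_j` — MASS PRESERVATION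
`∫ρ_j dV_j = Z_K` (✓`integral_emlDensity_eq_partitionFn` at level `j`) and (A) §1; `vol′_n` = the height-`n` Haar volume of the interior window ((A) `measureReal_window_level_eq`,
`K`-free).  No counterterm size (62)–(65) enters.  (A)'s `ae_quotient_bounds_level` with the window SHRUNK by `1 ∕ max B₃ 1`.
[cite: Balaban1985UV3, (5)–(6) pp.256–257, (41) p.266, (46)–(47) p.267, Thm 2 p.272; Balaban1985Variational, Thm 1 (8) p.279] -/
theorem ae_quotient_bounds_level_chi (p : AlphaInputsT3AC.PkgAtV4Chi F 𝔠 γ hγ hγ1 K) (hK : n ≤ K)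
    (ha₁ : ∀ i : ℕ, θBal F.L γ 𝔠.b₀ 𝔠.p₀ i ≤ p.a₁) {CP CRu B M : ℝ} (hCRu : 0 < CRu) (hB : 0 < B)
    (hP : ∀ (r : Hist (F.P K) (K - n)) (W : GaugeField (F.P K) (K - n) (Matrix.specialUnitaryGroup (Fin 2) ℂ)), |p.toRows.T.Pint (K - n) r W| ≤ CP)
    (hRm : Real.exp (p.toRows.T.Rm (K - n)) ≤ CRu)
    (hBae : ∀ᵐ W ∂fieldMeasure (F.P K) (K - n) (Matrix.specialUnitaryGroup (Fin 2) ℂ),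
      ∑ r : Hist (F.P K) (K - n), p.toRows.wtP (K - n) r W * Real.exp (-(p.toRows.T.mainT (K - n) r W) + p.toRows.T.Zterm (K - n) r) ≤ B)
    (hM : ∀ (W : GaugeField (F.P K) (K - n) (Matrix.specialUnitaryGroup (Fin 2) ℂ)), PlaqSmall (θBal F.L γ 𝔠.b₀ 𝔠.p₀ n / max 𝔠.B₃ 1) W →
      p.toRows.T.mainT (K - n) (p.toRows.T.triv (K - n)) W ≤ M) :
    (∀ᵐ W ∂fieldMeasure (F.P K) (K - n) (Matrix.specialUnitaryGroup (Fin 2) ℂ),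
      (partitionFn (G := Matrix.specialUnitaryGroup (Fin 2) ℂ) (F.P K) ((F.scheme ℰp γ).β K))⁻¹ * resDensity F γ K Set.univ (K - n) W ≤
        (CRu * Real.exp CP * B) / ((CRu⁻¹ * Real.exp (-M - CP)) *
          (fieldMeasure (F.P n) 0 (Matrix.specialUnitaryGroup (Fin 2) ℂ)).real
            {V : GaugeField (F.P n) 0 (Matrix.specialUnitaryGroup (Fin 2) ℂ) | PlaqSmall (θBal F.L γ 𝔠.b₀ 𝔠.p₀ n / max 𝔠.B₃ 1) V})) ∧
    (∀ᵐ W ∂fieldMeasure (F.P K) (K - n) (Matrix.specialUnitaryGroup (Fin 2) ℂ), PlaqSmall (θBal F.L γ 𝔠.b₀ 𝔠.p₀ n / max 𝔠.B₃ 1) W →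
      (CRu⁻¹ * Real.exp (-M - CP)) / (CRu * Real.exp CP * B) ≤
        (partitionFn (G := Matrix.specialUnitaryGroup (Fin 2) ℂ) (F.P K) ((F.scheme ℰp γ).β K))⁻¹ * resDensity F γ K Set.univ (K - n) W) := by
  haveI := isProbabilityMeasure_fieldMeasure (G := Matrix.specialUnitaryGroup (Fin 2) ℂ) (F.P K) (K - n)
  -- the two halves at level `K − n` (upper over the rows record `p.toRows`, lower over the χ-package on the interior window)
  have hup := ae_resDensity_le_anchor_rows p.toRows (K - n) (Nat.sub_le K n) (CP := CP) (fun r W => (abs_le.mp (hP r W)).2) hRm hBae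
  have hlow' := ae_anchor_le_resDensity_int p ha₁ (K - n) (Nat.sub_le K n) (CP := CP) (M := M)
    (fun W => (abs_le.mp (hP (p.toRows.T.triv (K - n)) W)).1) hRm
    (fun W hW => hM W ((mem_intWindowT3_level_iff hK W).1 hW))
  have hlow : ∀ᵐ W ∂fieldMeasure (F.P K) (K - n) (Matrix.specialUnitaryGroup (Fin 2) ℂ),
      W ∈ {W : GaugeField (F.P K) (K - n) (Matrix.specialUnitaryGroup (Fin 2) ℂ) | PlaqSmall (θBal F.L γ 𝔠.b₀ 𝔠.p₀ n / max 𝔠.B₃ 1) W} →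
        Real.exp (-(p.toRows.T.Ecst (K - n) - p.toRows.E)) * (CRu⁻¹ * Real.exp (-M - CP)) ≤ resDensity F γ K Set.univ (K - n) W := by
    filter_upwards [hlow'] with W hW hWS
    exact hW ((mem_intWindowT3_level_iff hK W).2 hWS)
  -- integrability, nonnegativity, mass preservation, window volume
  have hint : Integrable (resDensity F γ K Set.univ (K - n)) (fieldMeasure (F.P K) (K - n) (Matrix.specialUnitaryGroup (Fin 2) ℂ)) :=
    integrable_resDensity F K MeasurableSet.univ hγ.le (by omega)
  have h0 : ∀ W, 0 ≤ resDensity F γ K Set.univ (K - n) W := resDensity_nonneg F γ K Set.univ (K - n)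
  have hZ : ∫ W, resDensity F γ K Set.univ (K - n) W ∂fieldMeasure (F.P K) (K - n) (Matrix.specialUnitaryGroup (Fin 2) ℂ) =
      partitionFn (G := Matrix.specialUnitaryGroup (Fin 2) ℂ) (F.P K) ((F.scheme ℰp γ).β K) := by
    rw [UV3UnitPartitionLowerOfPackage.resDensity_univ_eq,
      UV3PinnedRatioOfTowerBounds.integral_emlDensity_eq_partitionFn F K hγ.le (K - n) (by omega)]
  have hS := measurableSet_plaqSmall (G := Matrix.specialUnitaryGroup (Fin 2) ℂ) (P := F.P K) (j := K - n) (θBal F.L γ 𝔠.b₀ 𝔠.p₀ n / max 𝔠.B₃ 1)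
  have hvol : 0 < (fieldMeasure (F.P K) (K - n) (Matrix.specialUnitaryGroup (Fin 2) ℂ)).real
      {W : GaugeField (F.P K) (K - n) (Matrix.specialUnitaryGroup (Fin 2) ℂ) | PlaqSmall (θBal F.L γ 𝔠.b₀ 𝔠.p₀ n / max 𝔠.B₃ 1) W} := by
    rw [measureReal_window_level_eq F hK]
    exact ENNReal.toReal_pos (fieldMeasure_plaqSmall_pos (P := F.P n) (j := 0) (intWindow_radius_pos 𝔠 hγ hγ1 n)).ne' (measure_ne_top _ _)
  have he : 0 < Real.exp (-(p.toRows.T.Ecst (K - n) - p.toRows.E)) := Real.exp_pos _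
  have hℓ : 0 < CRu⁻¹ * Real.exp (-M - CP) := by positivity
  have hU : 0 < CRu * Real.exp CP * B := by positivity
  refine ⟨?_, ?_⟩
  · have h := ae_inv_integral_mul_le_of_halves hint h0 hS hvol he hℓ hup hlow
    rw [hZ, measureReal_window_level_eq F hK] at h
    exact h
  · have h := ae_le_inv_integral_mul_of_halves hint h0 hS hvol he hU hℓ hup hlow
    rw [hZ] at h
    filter_upwards [h] with W hW hsmall using hW hsmall

end Height


/-! ## §4 The profile-shift letters: the interior window at profile `B·b₀` is print's full window at profile `b₀` -/

section Profile

/-- **`θBal` IS LINEAR IN THE PROFILE CONSTANT `b₀`, READ AS A SHIFT**: `θBal L γ (B·b₀) p₀ n ∕ B = θBal L γ b₀ p₀ n` for `B ≠ 0` (lit ✓`θBal_mul`).  With `B := max B₃ 1` pinned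
uniformly in the profile (the supplier ✓`pinnedPartsT3ACRecSelXsV4Chi_of_thm1_rows` returns `𝔠.B₃ = B` for every profile), the interior window of the package at profile
`(B·b₀, p₀)` IS print's window `{PlaqSmall θBal(b₀, p₀, n)}` at the caller's profile.  (Quotient form `θBal(b₀∕c) = θBal(b₀)∕c`:
✓`PoincareLipschitzQuantileOfMeanDeviation.θBal_profile_div`, not restated.) [cite: Balaban1985UV3, (7) p.257] -/
theorem θBal_profile_mul_div (L : ℕ) (γ b₀ p₀ : ℝ) (n : ℕ) {B : ℝ} (hB : B ≠ 0) :
    θBal L γ (B * b₀) p₀ n / B = θBal L γ b₀ p₀ n := by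
  rw [θBal_mul]
  field_simp

/-- **PRINT'S WINDOW AT PROFILE `b₀` = THE INTERIOR WINDOW AT PROFILE `B·b₀`** (any field, any level; `B ≠ 0`). [cite: Balaban1985UV3, (4) p.256 + (7) p.257] -/
theorem plaqSmall_interior_of_profile_mul_iff {P : Params} {j : ℕ} (L : ℕ) (γ b₀ p₀ : ℝ) (n : ℕ) {B : ℝ} (hB : B ≠ 0)
    (W : GaugeField P j (Matrix.specialUnitaryGroup (Fin 2) ℂ)) :
    PlaqSmall (θBal L γ (B * b₀) p₀ n / B) W ↔ PlaqSmall (θBal L γ b₀ p₀ n) W := by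
  rw [θBal_profile_mul_div L γ b₀ p₀ n hB]

end Profile

end Summit.QuantumFields.YangMills.Theorems.FluctuationComparisonRegPrIntLHeightwiseQuotientAnchoringChi

end
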